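import Literature.AnabelianGeometry.SemiGraphs.TemperedSpecialFibreReductions
import Literature.AnabelianGeometry.SemiGraphs.TemperedSpecialFibreDataVertexAction
import Literature.AnabelianGeometry.SemiGraphs.TemperedSpecialFibreReductionsInertia
import HarnessLib

/-!
# [SemiAnbd] Cor. 3.11, step (S1) «the admissible quotient is compatible with `γ`» CUT DOWN to its
# group-theoretic kernel form — the descent of `γ` along the admissible quotients is CONSTRUCTED

Mochizuki, *Semi-graphs of anabelioids*, Publ. RIMS **42** (2006), §3, Corollary 3.11, proof, manuscript
pp. 48–49 = PRIMS pp. 274–275 [cite: MochizukiSemiAnbd2006, Cor 3.11 pp.48-49]: "Next, let us observe that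
the natural quotient `Δ[□] ↠ π₁^temp(G[□]) ≅ π₁^temp(G^c[□])` — i.e., the quotient determined by the
'admissible quotient' of `Δ̂[□]`, in the sense of [Mzk3], §2 — may be characterized as follows: A normal open
subgroup of finite index `Δ'[□] ⊆ Δ[□]` arises from this quotient if and only if no irreducible component of
the special fiber of the stable model of the corresponding covering collapses …, and, moreover, the
decomposition groups at the nodes and cusps (respectively, inertia groups at the irreducible components) of
the corresponding covering are prime to `p` (respectively, trivial). … Then observe that this
characterization is equivalent to the following 'group-theoretic' condition [i.e., condition compatible with
`γ`]: … Thus, we conclude that `γ` induces an isomorphism `π₁^temp(G[α]) ≅ π₁^temp(G[β])`".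

The typed step (S1) `AdmissibleQuotientCompatible Ωα Ωβ` (`TemperedSpecialFibreReductions.lean`, FACT-policy,
fact-list row F-1724) asks, for `γ : Δ[α] ⥲ Δ[β]`, an isomorphism `φ : π₁^temp(G^c[α]) ⥲ π₁^temp(G^c[β])` of
topological groups with `φ ∘ q_α = q_β ∘ γ`.  This proof-structure file SPLITS it:

* the CONSTRUCTION (kernel-checked): `SpecialFibreData.descend` — if `γ` carries `Ker(q_α)` onto `Ker(q_β)`
  (`SpecialFibreData.KernelCompatible`, print's "condition compatible with `γ`"), then `q_β ∘ γ` descends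
  through the surjection `q_α` to a group isomorphism `φ`, which is a HOMEOMORPHISM because the admissible
  quotients are open quotient maps — PROVED in the tree (`SpecialFibreData.isOpenMap_admissible`, the open
  mapping theorem between the tempered, Galois-countable groups `Δ` and `π₁^temp(G^c)`, Def. 3.1 (i) p. 33);
  conversely a compatible `φ` forces kernel compatibility; so
  `SpecialFibreData.exists_compatible_iff_kernelCompatible` and, at the origin hypotheses,
  `admissibleQuotientCompatible_iff_admissibleKernelCompatible : (S1) ↔ (S1a)`;
* the RESIDUAL (S1a) `AdmissibleKernelCompatible Ωα Ωβ` — `γ(Ker q_α) = Ker q_β` for certified special-fibre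
  data — the FACT-policy content of print's characterisation (purity of the branch locus, "structure of local
  fundamental groups of stable curves" [Tama2, Lem. 2.1]); typed, consumed BY NAME, asserted for no instance;
* print's LITERAL finite-level shape: `SpecialFibreData.FiniteLevelCompatible` («a normal open subgroup of
  finite index arises from the quotient [for `α`] iff [its `γ`-image does for `β`]») is EQUIVALENT to kernel
  compatibility once the admissible kernel is cut out by the finite-index open normal subgroups containing it
  (`SpecialFibreData.IsProfinitelyDetermined` — print's "the quotient determined by the 'admissible quotient'
  of `Δ̂[□]`", i.e. by a quotient of the PROFINITE completion):
  `kernelCompatible_iff_finiteLevelCompatible`.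

With (S1a) in place of (S1) the Cor. 3.11 assemblies read `corollary_3_11_of_kernelCompatible`
(`corollary_3_11_of_steps` of `TemperedSpecialFibreReductions.lean`),
`corollary_3_11_of_kernelCompatible_cuspBranches` (`corollary_3_11_of_steps_cuspBranches`, the cusp-matching
path) and `corollary_3_11_of_all_cuts` (`corollary_3_11_of_cuts` of `TemperedSpecialFibreReductionsInertia.lean`:
the residual of record `Cor311 ⇐ finiteness ∧ (S1a) ∧ (S2a)×2 ∧ (S2b) ∧ CuspBranchesPreserved`).  No statement of the frozen files is altered;
typed ≠ proved; nothing here takes a side on [IUTchIII] Cor. 3.12 and nothing asserts or refutes abc.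
-/

noncomputable section

namespace Literature.AnabelianGeometry.SemiGraphs

open ProfiniteSemiGraph Topology

universe u

namespace SpecialFibreData

variable {Kα : Type u} [Field Kα] {Kβ : Type u} [Field Kβ]
  {Dα : TemperedArithmeticGroup Kα} {Dβ : TemperedArithmeticGroup Kβ}
  (Sα : SpecialFibreData Dα) (Sβ : SpecialFibreData Dβ)

/-! ### The admissible quotient is a quotient map -/

omit [Field Kα] in
/-- **`Δ ↠ π₁^temp(G^c)` is a topological quotient map** (it is a continuous OPEN surjection,
`isOpenMap_admissible`): print's "the natural quotient `Δ[□] ↠ π₁^temp(G[□]) ≅ π₁^temp(G^c[□])`" (p. 48).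
[cite: MochizukiSemiAnbd2006, Cor 3.11 p.48] -/
theorem isQuotientMap_admissible {K : Type u} [Field K] {D : TemperedArithmeticGroup K}
    (S : SpecialFibreData D) : IsQuotientMap S.admissible :=
  S.isOpenMap_admissible.isQuotientMap S.admissible.continuous S.admissible_surjective

/-! ### Kernel compatibility of `γ` and the descended isomorphism -/

/-- `γ : Δ[α] ⥲ Δ[β]` is **compatible with the admissible quotients** when it carries `Ker(q_α)` onto
`Ker(q_β)` (`q_□ = S□.admissible : Δ[□] ↠ π₁^temp(G^c[□])`) — print's "'group-theoretic' condition [i.e.,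
condition compatible with `γ`]" characterising the admissible quotient (p. 49), in kernel form.
[cite: MochizukiSemiAnbd2006, Cor 3.11 pp.48-49] -/
def KernelCompatible (γ : Dα.delta ≃ₜ* Dβ.delta) : Prop :=
  ∀ x : Dα.delta, Sα.admissible x = 1 ↔ Sβ.admissible (γ x) = 1

variable {Sα Sβ}

/-- Kernel compatibility in subgroup form: `γ(Ker q_α) = Ker q_β`. [cite: MochizukiSemiAnbd2006, Cor 3.11 pp.48-49] -/
theorem kernelCompatible_iff_map_ker (γ : Dα.delta ≃ₜ* Dβ.delta) :
    Sα.KernelCompatible Sβ γ ↔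
      Sα.admissible.toMonoidHom.ker.map γ.toMonoidHom = Sβ.admissible.toMonoidHom.ker := by
  constructor
  · intro h
    ext y
    constructor
    · rintro ⟨x, hx, rfl⟩
      exact (h x).1 hx
    · intro hy
      refine ⟨γ.symm y, ?_, γ.apply_symm_apply y⟩
      have : Sβ.admissible (γ (γ.symm y)) = 1 := by rw [γ.apply_symm_apply]; exact hy
      exact (h (γ.symm y)).2 this
  · intro h x
    constructor
    · intro hx
      have : γ x ∈ Sβ.admissible.toMonoidHom.ker := by rw [← h]; exact ⟨x, hx, rfl⟩
      exact this
    · intro hx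
      have hx' : γ x ∈ Sα.admissible.toMonoidHom.ker.map γ.toMonoidHom := by rw [h]; exact hx
      obtain ⟨x', hx', hxx'⟩ := hx'
      have : x' = x := γ.injective hxx'
      subst this
      exact hx'

/-- Kernel compatibility is symmetric: `γ⁻¹` carries `Ker(q_β)` onto `Ker(q_α)`.
[cite: MochizukiSemiAnbd2006, Cor 3.11 pp.48-49] -/
theorem KernelCompatible.symm {γ : Dα.delta ≃ₜ* Dβ.delta} (h : Sα.KernelCompatible Sβ γ) :
    Sβ.KernelCompatible Sα γ.symm := by
  intro y
  have := h (γ.symm y)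
  rw [γ.apply_symm_apply] at this
  exact this.symm

/-- Under kernel compatibility, `q_β ∘ γ` kills `Ker(q_α)`. [cite: MochizukiSemiAnbd2006, Cor 3.11 pp.48-49] -/
theorem KernelCompatible.ker_le {γ : Dα.delta ≃ₜ* Dβ.delta} (h : Sα.KernelCompatible Sβ γ) :
    Sα.admissible.toMonoidHom.ker ≤ (Sβ.admissible.toMonoidHom.comp γ.toMonoidHom).ker := by
  intro x hx
  rw [MonoidHom.mem_ker] at hx ⊢
  exact (h x).1 hx

variable (Sα Sβ)

/-- The **descended homomorphism** `φ : π₁^temp(G^c[α]) → π₁^temp(G^c[β])`: the lift of `q_β ∘ γ` through the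
surjection `q_α` (print p. 49 "`γ` induces an isomorphism `π₁^temp(G[α]) ≅ π₁^temp(G[β])`").
[cite: MochizukiSemiAnbd2006, Cor 3.11 p.49] -/
def descendHom (γ : Dα.delta ≃ₜ* Dβ.delta) (h : Sα.KernelCompatible Sβ γ) : Sα.chart.G →* Sβ.chart.G :=
  Sα.admissible.toMonoidHom.liftOfSurjective Sα.admissible_surjective
    ⟨Sβ.admissible.toMonoidHom.comp γ.toMonoidHom, h.ker_le⟩

/-- The defining square `φ (q_α x) = q_β (γ x)`. [cite: MochizukiSemiAnbd2006, Cor 3.11 p.49] -/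
theorem descendHom_admissible (γ : Dα.delta ≃ₜ* Dβ.delta) (h : Sα.KernelCompatible Sβ γ) (x : Dα.delta) :
    Sα.descendHom Sβ γ h (Sα.admissible x) = Sβ.admissible (γ x) :=
  MonoidHom.liftOfRightInverse_comp_apply _ _ _ _ x

/-- The descended homomorphism is CONTINUOUS: `q_α` is a quotient map and `φ ∘ q_α = q_β ∘ γ` is continuous.
[cite: MochizukiSemiAnbd2006, Cor 3.11 p.49] -/
theorem continuous_descendHom (γ : Dα.delta ≃ₜ* Dβ.delta) (h : Sα.KernelCompatible Sβ γ) :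
    Continuous (Sα.descendHom Sβ γ h) := by
  rw [Sα.isQuotientMap_admissible.continuous_iff]
  have : Sα.descendHom Sβ γ h ∘ Sα.admissible = Sβ.admissible ∘ γ :=
    funext fun x => Sα.descendHom_admissible Sβ γ h x
  rw [this]
  exact Sβ.admissible.continuous.comp γ.continuous

/-- **The isomorphism of topological groups `φ : π₁^temp(G^c[α]) ⥲ π₁^temp(G^c[β])` descended from a
kernel-compatible `γ`** (inverse = the descent of `γ⁻¹`). [cite: MochizukiSemiAnbd2006, Cor 3.11 p.49] -/
def descend (γ : Dα.delta ≃ₜ* Dβ.delta) (h : Sα.KernelCompatible Sβ γ) : Sα.chart.G ≃ₜ* Sβ.chart.G where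
  toFun := Sα.descendHom Sβ γ h
  invFun := Sβ.descendHom Sα γ.symm h.symm
  left_inv y := by
    obtain ⟨x, rfl⟩ := Sα.admissible_surjective y
    rw [descendHom_admissible, descendHom_admissible, γ.symm_apply_apply]
  right_inv y := by
    obtain ⟨x, rfl⟩ := Sβ.admissible_surjective y
    rw [descendHom_admissible, descendHom_admissible, γ.apply_symm_apply]
  map_mul' := map_mul _
  continuous_toFun := Sα.continuous_descendHom Sβ γ h
  continuous_invFun := Sβ.continuous_descendHom Sα γ.symm h.symm

/-- The defining square of the descended isomorphism: `φ (q_α x) = q_β (γ x)`.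
[cite: MochizukiSemiAnbd2006, Cor 3.11 p.49] -/
theorem descend_admissible (γ : Dα.delta ≃ₜ* Dβ.delta) (h : Sα.KernelCompatible Sβ γ) (x : Dα.delta) :
    Sα.descend Sβ γ h (Sα.admissible x) = Sβ.admissible (γ x) :=
  Sα.descendHom_admissible Sβ γ h x

/-- Conversely, an isomorphism `φ` with `φ ∘ q_α = q_β ∘ γ` forces `γ(Ker q_α) = Ker q_β`.
[cite: MochizukiSemiAnbd2006, Cor 3.11 pp.48-49] -/
theorem kernelCompatible_of_compatible (γ : Dα.delta ≃ₜ* Dβ.delta) (φ : Sα.chart.G ≃ₜ* Sβ.chart.G)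
    (hφ : ∀ x : Dα.delta, φ (Sα.admissible x) = Sβ.admissible (γ x)) : Sα.KernelCompatible Sβ γ := by
  intro x
  rw [← hφ x]
  constructor
  · intro hx
    rw [hx, map_one]
  · intro hx
    apply φ.injective
    rw [hx, map_one]

/-- **(S1) at one pair of data ⟺ kernel compatibility**: a `γ`-compatible isomorphism of the tempered
fundamental groups of the special fibres EXISTS iff `γ(Ker q_α) = Ker q_β`; it is then `descend`
(and unique, `descended_unique`). [cite: MochizukiSemiAnbd2006, Cor 3.11 pp.48-49] -/
theorem exists_compatible_iff_kernelCompatible (γ : Dα.delta ≃ₜ* Dβ.delta) :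
    (∃ φ : Sα.chart.G ≃ₜ* Sβ.chart.G, ∀ x : Dα.delta, φ (Sα.admissible x) = Sβ.admissible (γ x)) ↔
      Sα.KernelCompatible Sβ γ :=
  ⟨fun ⟨φ, hφ⟩ => Sα.kernelCompatible_of_compatible Sβ γ φ hφ,
    fun h => ⟨Sα.descend Sβ γ h, Sα.descend_admissible Sβ γ h⟩⟩

/-- Any `γ`-compatible isomorphism IS the descended one. [cite: MochizukiSemiAnbd2006, Cor 3.11 p.49] -/
theorem eq_descend_of_compatible (γ : Dα.delta ≃ₜ* Dβ.delta) (φ : Sα.chart.G ≃ₜ* Sβ.chart.G)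
    (hφ : ∀ x : Dα.delta, φ (Sα.admissible x) = Sβ.admissible (γ x)) :
    φ = Sα.descend Sβ γ (Sα.kernelCompatible_of_compatible Sβ γ φ hφ) :=
  Sα.descended_unique Sβ γ (Sα.descend_admissible Sβ γ _) hφ

/-! ### Print's literal finite-level shape -/

/-- **Print's literal shape of the characterisation**, relative to `γ`: "a normal open subgroup of finite
index `Δ'[□] ⊆ Δ[□]` arises from this quotient if and only if [a 'group-theoretic' condition, i.e.,
condition compatible with `γ`]" (pp. 48–49) — so the finite-index open normal subgroups of `Δ[α]` through
which `q_α` factors correspond under `γ` to those of `Δ[β]` through which `q_β` factors.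
[cite: MochizukiSemiAnbd2006, Cor 3.11 pp.48-49] -/
def FiniteLevelCompatible (γ : Dα.delta ≃ₜ* Dβ.delta) : Prop :=
  ∀ N : Subgroup Dα.delta, N.Normal → IsOpen (N : Set Dα.delta) → N.FiniteIndex →
    (Sα.admissible.toMonoidHom.ker ≤ N ↔ Sβ.admissible.toMonoidHom.ker ≤ N.map γ.toMonoidHom)

/-- **The admissible kernel is cut out by its finite levels**: an element of `Δ` lying in every
finite-index open normal subgroup through which `q` factors lies in `Ker q` — print's "the quotient
determined by the 'admissible quotient' of `Δ̂[□]`, in the sense of [Mzk3], §2" (p. 48: the quotient is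
determined by a quotient of the PROFINITE completion `Δ̂`, i.e. by its finite levels; equivalently
`π₁^temp(G^c)` is residually finite). A property of the datum, recorded as a hypothesis predicate.
[cite: MochizukiSemiAnbd2006, Cor 3.11 p.48] -/
def IsProfinitelyDetermined {K : Type u} [Field K] {D : TemperedArithmeticGroup K} (S : SpecialFibreData D) :
    Prop :=
  ∀ x : D.delta, (∀ N : Subgroup D.delta, N.Normal → IsOpen (N : Set D.delta) → N.FiniteIndex →
    S.admissible.toMonoidHom.ker ≤ N → x ∈ N) → S.admissible x = 1

variable {Sα Sβ}

/-- The image of a subgroup under `γ`, as the preimage under `γ⁻¹`. [folklore] -/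
private theorem map_eq_comap_symm (γ : Dα.delta ≃ₜ* Dβ.delta) (N : Subgroup Dα.delta) :
    N.map γ.toMonoidHom = N.comap γ.symm.toMonoidHom := by
  ext y
  constructor
  · rintro ⟨x, hx, rfl⟩
    show γ.symm (γ x) ∈ N
    rw [γ.symm_apply_apply]; exact hx
  · intro hy
    exact ⟨γ.symm y, hy, γ.apply_symm_apply y⟩

/-- `γ` carries finite-index open normal subgroups to finite-index open normal subgroups. [folklore] -/
private theorem normal_open_finiteIndex_map (γ : Dα.delta ≃ₜ* Dβ.delta) {N : Subgroup Dα.delta}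
    (hN : N.Normal) (hO : IsOpen (N : Set Dα.delta)) (hF : N.FiniteIndex) :
    (N.map γ.toMonoidHom).Normal ∧ IsOpen (N.map γ.toMonoidHom : Set Dβ.delta) ∧
      (N.map γ.toMonoidHom).FiniteIndex := by
  rw [map_eq_comap_symm]
  refine ⟨Subgroup.Normal.comap hN _, ?_, ?_⟩
  · rw [Subgroup.coe_comap]
    exact hO.preimage γ.symm.continuous
  · refine ⟨?_⟩
    rw [Subgroup.index_comap_of_surjective _ γ.symm.surjective]
    exact hF.1

/-- **Kernel compatibility ⇒ print's finite-level shape** (unconditionally): if `γ(Ker q_α) = Ker q_β`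
then `Ker q_α ≤ N ↔ Ker q_β ≤ γ(N)`. [cite: MochizukiSemiAnbd2006, Cor 3.11 pp.48-49] -/
theorem finiteLevelCompatible_of_kernelCompatible {γ : Dα.delta ≃ₜ* Dβ.delta}
    (h : Sα.KernelCompatible Sβ γ) : Sα.FiniteLevelCompatible Sβ γ := by
  intro N _ _ _
  rw [← (kernelCompatible_iff_map_ker γ).1 h]
  constructor
  · exact fun hle => Subgroup.map_mono hle
  · intro hle x hx
    obtain ⟨x', hx', hxx'⟩ := hle ⟨x, hx, rfl⟩
    have : x' = x := γ.injective hxx'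
    subst this
    exact hx'

/-- **Print's finite-level shape ⇒ kernel compatibility**, for admissible kernels cut out by their finite
levels on both sides: the argument of p. 49 "Thus, we conclude that `γ` induces an isomorphism
`π₁^temp(G[α]) ≅ π₁^temp(G[β])`". [cite: MochizukiSemiAnbd2006, Cor 3.11 p.49] -/
theorem kernelCompatible_of_finiteLevelCompatible {γ : Dα.delta ≃ₜ* Dβ.delta}
    (hα : Sα.IsProfinitelyDetermined) (hβ : Sβ.IsProfinitelyDetermined)
    (h : Sα.FiniteLevelCompatible Sβ γ) : Sα.KernelCompatible Sβ γ := by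
  intro x
  constructor
  · intro hx
    apply hβ
    intro M hM hMo hMf hle
    -- pull `M` back along `γ`
    have hpre := normal_open_finiteIndex_map γ.symm hM hMo hMf
    have hmap : (M.map γ.symm.toMonoidHom).map γ.toMonoidHom = M := by
      ext y
      constructor
      · rintro ⟨x, ⟨y', hy', rfl⟩, rfl⟩
        show γ (γ.symm y') ∈ M
        rw [γ.apply_symm_apply]; exact hy'
      · intro hy
        exact ⟨γ.symm y, ⟨y, hy, rfl⟩, γ.apply_symm_apply y⟩
    have hle' : Sα.admissible.toMonoidHom.ker ≤ M.map γ.symm.toMonoidHom := by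
      rw [h _ hpre.1 hpre.2.1 hpre.2.2, hmap]; exact hle
    obtain ⟨y, hy, hyx⟩ := hle' (show x ∈ Sα.admissible.toMonoidHom.ker from hx)
    have : γ x = y := by rw [← hyx]; exact γ.apply_symm_apply y
    rw [this]; exact hy
  · intro hx
    apply hα
    intro N hN hNo hNf hle
    have hle' : Sβ.admissible.toMonoidHom.ker ≤ N.map γ.toMonoidHom := (h N hN hNo hNf).1 hle
    obtain ⟨x', hx', hxx'⟩ := hle' (show γ x ∈ Sβ.admissible.toMonoidHom.ker from hx)
    have : x' = x := γ.injective hxx'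
    subst this
    exact hx'

/-- **Kernel compatibility ⟺ print's finite-level shape**, for admissible kernels cut out by their finite
levels. [cite: MochizukiSemiAnbd2006, Cor 3.11 pp.48-49] -/
theorem kernelCompatible_iff_finiteLevelCompatible {γ : Dα.delta ≃ₜ* Dβ.delta}
    (hα : Sα.IsProfinitelyDetermined) (hβ : Sβ.IsProfinitelyDetermined) :
    Sα.KernelCompatible Sβ γ ↔ Sα.FiniteLevelCompatible Sβ γ :=
  ⟨finiteLevelCompatible_of_kernelCompatible, kernelCompatible_of_finiteLevelCompatible hα hβ⟩

end SpecialFibreData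

/-! ### (S1a): the named residual at the origin hypotheses, and (S1) ⟺ (S1a) -/

section Cor311

variable {Kα : Type u} [Field Kα] {Kβ : Type u} [Field Kβ]

/-- (S1a) **The admissible quotient is group-theoretic — kernel form** ([SemiAnbd] Cor. 3.11, proof,
pp. 48–49: the natural quotient `Δ[□] ↠ π₁^temp(G^c[□])` "may be characterized" by a "'group-theoretic'
condition [i.e., condition compatible with `γ`]" — via "purity of the branch locus" and "the well-known
'structure of local fundamental groups of stable curves' [cf., e.g., [Tama2], Lemma 2.1]"), named residual
fact over the origin hypotheses (assumed by consumers, asserted for no instance): every isomorphism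
`γ : Δ[α] ⥲ Δ[β]` carries the kernel of the admissible quotient of `α` onto that of `β`. The STRUCTURAL half
of (S1) — that `γ` then descends to an isomorphism of TOPOLOGICAL groups — is kernel-checked
(`SpecialFibreData.descend`). [cite: MochizukiSemiAnbd2006, Cor 3.11 pp.48-49] -/
def AdmissibleKernelCompatible (Ωα : SpecialFibreOrigin Kα) (Ωβ : SpecialFibreOrigin Kβ) : Prop :=
  ∀ (Dα : TemperedArithmeticGroup Kα) (Dβ : TemperedArithmeticGroup Kβ)
    (Sα : SpecialFibreData Dα) (Sβ : SpecialFibreData Dβ),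
    Ωα.IsSpecialFibreOf Dα Sα → Ωβ.IsSpecialFibreOf Dβ Sβ →
    ∀ γ : Dα.delta ≃ₜ* Dβ.delta, Sα.KernelCompatible Sβ γ

/-- **(S1) ⟺ (S1a)**: the typed step (S1) `AdmissibleQuotientCompatible` (fact-list row F-1724) is
EQUIVALENT to its kernel form; the descent and its bicontinuity are constructions, not assumptions.
[cite: MochizukiSemiAnbd2006, Cor 3.11 pp.48-49] -/
theorem admissibleQuotientCompatible_iff_admissibleKernelCompatible (Ωα : SpecialFibreOrigin Kα)
    (Ωβ : SpecialFibreOrigin Kβ) :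
    AdmissibleQuotientCompatible Ωα Ωβ ↔ AdmissibleKernelCompatible Ωα Ωβ := by
  constructor
  · intro h Dα Dβ Sα Sβ hα hβ γ
    exact (Sα.exists_compatible_iff_kernelCompatible Sβ γ).1 (h Dα Dβ Sα Sβ hα hβ γ)
  · intro h Dα Dβ Sα Sβ hα hβ γ
    exact (Sα.exists_compatible_iff_kernelCompatible Sβ γ).2 (h Dα Dβ Sα Sβ hα hβ γ)

/-- **(S1a) ⇒ (S1)**, the direction consumers use. [cite: MochizukiSemiAnbd2006, Cor 3.11 pp.48-49] -/
theorem admissibleQuotientCompatible_of_admissibleKernelCompatible {Ωα : SpecialFibreOrigin Kα}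
    {Ωβ : SpecialFibreOrigin Kβ} (h : AdmissibleKernelCompatible Ωα Ωβ) :
    AdmissibleQuotientCompatible Ωα Ωβ :=
  (admissibleQuotientCompatible_iff_admissibleKernelCompatible Ωα Ωβ).2 h

/-- **[SemiAnbd] Cor. 3.11 from (S1a), (S2), (S3)** — `corollary_3_11_of_steps` with (S1) supplied by the
descent construction. [cite: MochizukiSemiAnbd2006, Cor 3.11 pp.45-49] -/
theorem corollary_3_11_of_kernelCompatible (pα pβ : ℕ) [Fact pα.Prime] [Fact pβ.Prime]
    [Algebra ℚ_[pα] Kα] [FiniteDimensional ℚ_[pα] Kα] [Algebra ℚ_[pβ] Kβ] [FiniteDimensional ℚ_[pβ] Kβ]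
    (Ωα : SpecialFibreOrigin Kα) (Ωβ : SpecialFibreOrigin Kβ)
    (hS1a : AdmissibleKernelCompatible Ωα Ωβ) (hS2 : ResidueCharOfTemperedIso pα pβ Ωα Ωβ)
    (hS3 : SpecialFibreIsoOfChartIso Ωα Ωβ) : Cor311 pα pβ Ωα Ωβ :=
  corollary_3_11_of_steps pα pβ Ωα Ωβ (admissibleQuotientCompatible_of_admissibleKernelCompatible hS1a)
    hS2 hS3

/-- **[SemiAnbd] Cor. 3.11 from (S1a), (S2), the cusp-matching step and the finiteness of the special
fibres** — `corollary_3_11_of_steps_cuspBranches` with (S1) supplied by the descent construction: the FACT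
residue of the printed proof now reads (S1a) `AdmissibleKernelCompatible`, (S2) `ResidueCharOfTemperedIso`,
print's (ii)–(iv) `CuspBranchesPreserved`, and the finiteness of the certified special fibres; everything
else (the descent of `γ` and its bicontinuity, Cor. 3.9 at `G[□]`, the extension along the cusps, all
uniqueness clauses) is kernel-checked. [cite: MochizukiSemiAnbd2006, Cor 3.11 pp.45-49] -/
theorem corollary_3_11_of_kernelCompatible_cuspBranches (pα pβ : ℕ) [Fact pα.Prime] [Fact pβ.Prime]
    [Algebra ℚ_[pα] Kα] [FiniteDimensional ℚ_[pα] Kα] [Algebra ℚ_[pβ] Kβ] [FiniteDimensional ℚ_[pβ] Kβ]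
    (Ωα : SpecialFibreOrigin Kα) (Ωβ : SpecialFibreOrigin Kβ)
    (hfinα : ∀ (D : TemperedArithmeticGroup Kα) (S : SpecialFibreData D), Ωα.IsSpecialFibreOf D S →
      Finite S.Gc.graph.Vertex ∧ Finite S.Gc.graph.Edge)
    (hfinβ : ∀ (D : TemperedArithmeticGroup Kβ) (S : SpecialFibreData D), Ωβ.IsSpecialFibreOf D S →
      Finite S.Gc.graph.Vertex ∧ Finite S.Gc.graph.Edge)
    (hS1a : AdmissibleKernelCompatible Ωα Ωβ) (hS2 : ResidueCharOfTemperedIso pα pβ Ωα Ωβ)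
    (hCB : CuspBranchesPreserved Ωα Ωβ) : Cor311 pα pβ Ωα Ωβ :=
  corollary_3_11_of_steps_cuspBranches pα pβ Ωα Ωβ hfinα hfinβ
    (admissibleQuotientCompatible_of_admissibleKernelCompatible hS1a) hS2 hCB

/-- **[SemiAnbd] Cor. 3.11 with ALL THREE cuts applied — the residual of record along the sub-DAG's path**:
`Cor311 ⇐ finiteness ∧ (S1a) ∧ (S2a)×2 ∧ (S2b) ∧ CuspBranchesPreserved` — `corollary_3_11_of_cuts`
(`TemperedSpecialFibreReductionsInertia.lean`: (S2) from the inertia sentences (S2a), (S2b) of p. 48, (S3′)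
from the cusp matching) with its step (S1) now supplied by the descent construction from the kernel form
(S1a).  Every hypothesis is a quoted sentence of the printed proof typed over the origin hypotheses and
asserted for no origin; the descent of `γ`, the transport of the inertia groups, Cor. 3.9 at `G[□]`, the
extension along the cusps and every uniqueness clause are kernel theorems.
[cite: MochizukiSemiAnbd2006, Cor 3.11 pp.45-49] -/
theorem corollary_3_11_of_all_cuts (pα pβ : ℕ) [Fact pα.Prime] [Fact pβ.Prime]
    [Algebra ℚ_[pα] Kα] [FiniteDimensional ℚ_[pα] Kα] [Algebra ℚ_[pβ] Kβ] [FiniteDimensional ℚ_[pβ] Kβ]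
    (Ωα : SpecialFibreOrigin Kα) (Ωβ : SpecialFibreOrigin Kβ) (S : Set ℕ)
    (hfinα : ∀ (D : TemperedArithmeticGroup Kα) (Sp : SpecialFibreData D), Ωα.IsSpecialFibreOf D Sp →
      Finite Sp.Gc.graph.Vertex ∧ Finite Sp.Gc.graph.Edge)
    (hfinβ : ∀ (D : TemperedArithmeticGroup Kβ) (Sp : SpecialFibreData D), Ωβ.IsSpecialFibreOf D Sp →
      Finite Sp.Gc.graph.Vertex ∧ Finite Sp.Gc.graph.Edge)
    (hS1a : AdmissibleKernelCompatible Ωα Ωβ) (hS2a : InertiaOrdersPrimePow S pα Ωα)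
    (hS2a' : InertiaOrdersPrimePow S pβ Ωβ) (hS2b : HasNontrivialInertia S Ωα)
    (hCB : CuspBranchesPreserved Ωα Ωβ) : Cor311 pα pβ Ωα Ωβ :=
  corollary_3_11_of_cuts pα pβ Ωα Ωβ S hfinα hfinβ
    (admissibleQuotientCompatible_of_admissibleKernelCompatible hS1a) hS2a hS2a' hS2b hCB

end Cor311

end Literature.AnabelianGeometry.SemiGraphs

end
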